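import Literature.MathematicalPhysics.QuantumManyBody.McMillanAllenDynes
import Mathlib.Analysis.Complex.ExponentialBounds
import HarnessLib

/-!
# Certified McMillan-formula UPPER bounds for e–ph «informative negative» rows

Venture CertifiedManyBodySolver, cell `pub/hubbard-eph` (conventional branch of the material oracle),
seat hubbard-eph-mod-2 (lead ask 2026-08-26T20:06Z, downfold-lit-4's suggestion); namespace
`Summit.Ventures.CertifiedManyBodySolver.Eph`. Everything here is PROVED.

WHAT THIS IS: certified ARITHMETIC on the McMillan formula
`T_c = (ω_log/1.2) exp(−1.04(1+λ)/(λ − μ*(1 + 0.62λ)))`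
(`Literature.MathematicalPhysics.QuantumManyBody.mcMillanTc`): if an electron–phonon calculation
prints a box `ω_log ≤ ω⁺`, `λ ≤ λ⁺` for a material, then for EVERY Coulomb pseudopotential `μ* ≥ 0` in
the formula's physical domain the McMillan `T_c` is at most its value at the corner `(ω⁺, λ⁺, μ* = 0)`
(`mcMillanTc_le_corner`), and that corner value is bounded by an explicit decimal
(`mcMillanTc_le_half_of_pnictide_box`: `≤ 0.5 K` on the LaFeAsO-class box `ω_log ≤ 206 K`, `λ ≤ 0.21`;
`mcMillanTc_le_of_FeSe_box`: `≤ 0.15 K` on `ω_log ≤ 163 K`, `λ ≤ 0.17`). The numeric step uses only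
`Real.exp_one_gt_d9` (`2.7182818283 < e`) and `Real.add_one_le_exp` (`exp_599_ge`; the `e⁷` bound is a
local step).

WHAT THIS IS NOT: a statement about any material's actual pairing mechanism (the iron pnictides
superconduct at 26 K / 8 K by a NON-phonon mechanism — these bounds certify only that the e–ph
McMillan reading of the published `λ` box is far below that); not a statement about the accuracy of
the McMillan formula versus the Eliashberg equations (empirical; at `λ ≤ 0.3` the Allen–Dynes factors
`f₁ f₂ ≥ 1` are irrelevant in the upward direction only in the sense `T_c^{McM} ≤ T_c^{AD}`,
`mcMillanTc_le_allenDynesTc` — the AD value on these boxes exceeds McMillan by < 1 %); the input boxes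
are SCREENING-GRADE literature numbers [float: Boeri, Dolgov, Golubov, PRL 101, 026403 (2008),
arXiv:0803.2703 p.1/p.3 — LaFeAsO `λ = 0.21` «an upper bound», `ω_log = 206 K`; Subedi, Zhang, Singh,
Du, PRB 78, 134514 (2008), arXiv:0807.4312 p.5 — FeSe `λ = 0.17`, `ω_log = 163 K`], they enter as
hypotheses, never as facts of the tree.

THE PHYSICAL-DOMAIN HYPOTHESIS (why `0 ≤ μ*` alone is not enough): the formula is meaningful only where
its denominator `λ − μ*(1 + 0.62λ)` is positive; there `T_c` is antitone in `μ*`, so `μ* = 0` is the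
worst case for an upper bound. Where the denominator is `≤ 0` the physics reading is «no
superconductivity from this channel» (an even stronger negative), but the Lean definition takes junk
values (`x/0 = 0` gives `T_c = ω/1.2`), so no theorem is stated there. Every bound below therefore
carries `0 < mcMillanDenom λ μ*` (which with `μ* ≥ 0` forces `λ > 0`) and `0.62 μ* ≤ 1`.
-/

noncomputable section

namespace Summit.Ventures.CertifiedManyBodySolver.Eph

open Real Literature.MathematicalPhysics.QuantumManyBody

/-! ## §1 The generic corner bound -/

/-- **Box ⇒ corner (upper bound).** On the physical domain (`0 ≤ μ*`, `0.62 μ* ≤ 1`, positive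
McMillan denominator at `(λ, μ*)`), for `0 ≤ ω_log ≤ ω⁺` and `λ ≤ λ⁺`:
`T_c^{McM}(ω_log, λ, μ*) ≤ T_c^{McM}(ω⁺, λ⁺, 0)`. The three steps are the tree's
`mcMillanTc_anti_mu` (drop `μ*` to `0`), `mcMillanTc_mono_lam` (raise `λ`), `mcMillanTc_mono_omega`
(raise `ω_log`). -/
theorem mcMillanTc_le_corner {ω ωhi lam lhi mu : ℝ} (hω0 : 0 ≤ ω) (hω : ω ≤ ωhi) (hl : lam ≤ lhi)
    (hmu : 0 ≤ mu) (hmu' : 0.62 * mu ≤ 1) (hD : 0 < mcMillanDenom lam mu) :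
    mcMillanTc ω lam mu ≤ mcMillanTc ωhi lhi 0 := by
  have hlam : 0 < lam := by
    have hD' := hD
    rw [mcMillanDenom_eq] at hD'
    rcases lt_or_ge 0 lam with h | hle
    · exact h
    · exfalso
      nlinarith [mul_nonneg (sub_nonneg.2 hmu') (neg_nonneg.2 hle), hmu]
  have hD0 : 0 < mcMillanDenom lam 0 := by rw [mcMillanDenom_eq]; linarith
  calc mcMillanTc ω lam mu ≤ mcMillanTc ω lam 0 := mcMillanTc_anti_mu hω0 hlam.le hmu hD
    _ ≤ mcMillanTc ω lhi 0 :=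
        mcMillanTc_mono_lam hω0 le_rfl (by norm_num) hD0 hl
    _ ≤ mcMillanTc ωhi lhi 0 := mcMillanTc_mono_omega lhi 0 hω

/-- **Corner ⇒ number.** If the exponent at the corner is at least `E₀` and `exp E₀ ≥ M > 0`, then
`T_c^{McM}(ω⁺, λ⁺, 0) ≤ (ω⁺/1.2)/M`. (Bookkeeping lemma: separates the monotonicity from the
decimal arithmetic.) -/
theorem mcMillanTc_zero_le_div {ωhi lhi E₀ M : ℝ} (hω : 0 ≤ ωhi) (hM : 0 < M)
    (hE : E₀ ≤ mcMillanExponent lhi 0) (hexp : M ≤ Real.exp E₀) :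
    mcMillanTc ωhi lhi 0 ≤ ωhi / 1.2 / M := by
  unfold mcMillanTc
  have h1 : Real.exp (-mcMillanExponent lhi 0) ≤ Real.exp (-E₀) := Real.exp_le_exp.2 (by linarith)
  have h2 : Real.exp (-E₀) ≤ 1 / M := by
    rw [Real.exp_neg, one_div]
    exact inv_anti₀ hM hexp
  have hω' : 0 ≤ ωhi / 1.2 := by positivity
  calc ωhi / 1.2 * Real.exp (-mcMillanExponent lhi 0) ≤ ωhi / 1.2 * (1 / M) :=
        mul_le_mul_of_nonneg_left (h1.trans h2) hω'
    _ = ωhi / 1.2 / M := by ring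

/-! ## §2 Decimal facts about `exp` -/

/-- `e⁶ · e^{−0.01} ≥ 399`: from `e > 2.7182818283` and `1 + x ≤ eˣ` at `x = −0.01`. -/
theorem exp_599_ge : (399 : ℝ) ≤ Real.exp 5.99 := by
  have h6 : Real.exp 6 = Real.exp 1 ^ 6 := by
    rw [← Real.exp_nat_mul 1 6]; norm_num
  have he : (2.7182818283 : ℝ) ^ 6 ≤ Real.exp 1 ^ 6 :=
    pow_le_pow_left₀ (by norm_num) Real.exp_one_gt_d9.le 6
  have hnum : (403.4 : ℝ) ≤ (2.7182818283 : ℝ) ^ 6 := by norm_num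
  have hsmall : (0.99 : ℝ) ≤ Real.exp (-0.01) := by
    have := Real.add_one_le_exp (-0.01 : ℝ); linarith
  have hsplit : Real.exp 5.99 = Real.exp 6 * Real.exp (-0.01) := by
    rw [← Real.exp_add]; norm_num
  rw [hsplit, h6]
  have h403 : (403.4 : ℝ) ≤ Real.exp 1 ^ 6 := hnum.trans he
  nlinarith [h403, hsmall, Real.exp_pos (-0.01 : ℝ)]

/-! ## §3 The two boxes -/

/-- The corner value of the LaFeAsO-class box: `T_c^{McM}(206 K, 0.21, 0) ≤ 0.5 K`
(`(206/1.2)·e^{−5.992…} ≈ 0.43 K`). -/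
theorem mcMillanTc_206_021_le_half : mcMillanTc 206 0.21 0 ≤ 0.5 := by
  have hE : (5.99 : ℝ) ≤ mcMillanExponent 0.21 0 := by
    unfold mcMillanExponent mcMillanDenom; norm_num
  have h := mcMillanTc_zero_le_div (ωhi := 206) (lhi := 0.21) (by norm_num) (by norm_num : (0:ℝ) < 399)
    hE exp_599_ge
  have : (206 : ℝ) / 1.2 / 399 ≤ 0.5 := by norm_num
  exact h.trans this

/-- The corner value of the FeSe-class box: `T_c^{McM}(163 K, 0.17, 0) ≤ 0.15 K`
(`(163/1.2)·e^{−7.158} ≈ 0.11 K`). -/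
theorem mcMillanTc_163_017_le : mcMillanTc 163 0.17 0 ≤ 0.15 := by
  have hE : (7 : ℝ) ≤ mcMillanExponent 0.17 0 := by
    unfold mcMillanExponent mcMillanDenom; norm_num
  -- `e⁷ ≥ 1096` (the tree has this as `Literature.Computability.MetaComplexity.exp_seven_ge`; restated
  -- locally to keep the import list physical)
  have h7 : (1096 : ℝ) ≤ Real.exp 7 := by
    have h7' : Real.exp 7 = Real.exp 1 ^ 7 := by
      rw [← Real.exp_nat_mul 1 7]; norm_num
    have he : (2.7182818283 : ℝ) ^ 7 ≤ Real.exp 1 ^ 7 :=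
      pow_le_pow_left₀ (by norm_num) Real.exp_one_gt_d9.le 7
    have hnum : (1096 : ℝ) ≤ (2.7182818283 : ℝ) ^ 7 := by norm_num
    rw [h7']; exact hnum.trans he
  have h := mcMillanTc_zero_le_div (ωhi := 163) (lhi := 0.17) (by norm_num) (by norm_num : (0:ℝ) < 1096)
    hE h7
  have : (163 : ℝ) / 1.2 / 1096 ≤ 0.15 := by norm_num
  exact h.trans this

/-- **LaFeAsO-class informative negative, certified at the McMillan-formula level.** For every
`ω_log ∈ [0, 206]` (K), `λ ∈ [0, 0.21]` and every `μ* ≥ 0` with `0.62 μ* ≤ 1` in the formula's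
physical domain (`λ − μ*(1 + 0.62λ) > 0`): `T_c^{McM} ≤ 0.5 K` — to be read against the measured
`26 K` [float]. (The lead's suggested signature had `0 ≤ μ*` only; the denominator hypothesis is what
makes the formula a formula — see the module docstring.) -/
theorem mcMillanTc_le_half_of_pnictide_box {ω lam mu : ℝ} (hω : ω ∈ Set.Icc (0 : ℝ) 206)
    (hl : lam ∈ Set.Icc (0 : ℝ) 0.21) (hmu : 0 ≤ mu) (hmu' : 0.62 * mu ≤ 1)
    (hD : 0 < mcMillanDenom lam mu) : mcMillanTc ω lam mu ≤ 0.5 :=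
  (mcMillanTc_le_corner hω.1 hω.2 hl.2 hmu hmu' hD).trans mcMillanTc_206_021_le_half

/-- **FeSe-class informative negative, certified at the McMillan-formula level.** For every
`ω_log ∈ [0, 163]` (K), `λ ∈ [0, 0.17]`, `μ* ≥ 0`, `0.62 μ* ≤ 1`, positive denominator:
`T_c^{McM} ≤ 0.15 K` — against the measured `8 K` [float]. -/
theorem mcMillanTc_le_of_FeSe_box {ω lam mu : ℝ} (hω : ω ∈ Set.Icc (0 : ℝ) 163)
    (hl : lam ∈ Set.Icc (0 : ℝ) 0.17) (hmu : 0 ≤ mu) (hmu' : 0.62 * mu ≤ 1)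
    (hD : 0 < mcMillanDenom lam mu) : mcMillanTc ω lam mu ≤ 0.15 :=
  (mcMillanTc_le_corner hω.1 hω.2 hl.2 hmu hmu' hD).trans mcMillanTc_163_017_le

end Summit.Ventures.CertifiedManyBodySolver.Eph

end
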